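import Mathlib
import HarnessLib
import Literature.Computability.AlgebraicComplexity.PatternExpressions
import Summits.ValiantsHypothesis.ValiantsHypothesis.Theorems.MonotoneRestorationMonotoneRestorationQPLinearWidthDefs
import Summits.ValiantsHypothesis.ValiantsHypothesis.Theorems.MonotoneRestorationMonotoneRestorationQPLinearWidthIsolationAnyLevel
import Summits.ValiantsHypothesis.ValiantsHypothesis.Theorems.MonotoneRestorationMonotoneRestorationQPLinearWidthDirectSumCongruence
import Summits.ValiantsHypothesis.ValiantsHypothesis.Theorems.MonotoneRestorationMonotoneRestorationQPLinearWidthLevelDownward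
import Summits.ValiantsHypothesis.ValiantsHypothesis.Theorems.MonotoneRestorationMonotoneRestorationQPLinearWidthSmallWitnessRung

/-!
# Route MonotoneRestoration, crux `MonotoneRestorationQP` (stmt-15886), line `linear_width` —
# THE LINEAR-WITNESS RUNG: degree `√N` from witnesses of size LINEAR IN THE PATTERN (step (P5) of the g13 census)

Helper file (`--supports stmt-ValiantsHypothesis-15886`), def-free.

`SmallWitnessRung` (p840965) / `SqrtRung` (p841022) close the `√N` rung of `WidthRung` modulo (W1)_g — witnesses whose
size `g(k)` depends on the WIDTH `k` only, polynomially; that input is not in print.  The isolation lemma they rest on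
(`IsolationAnyLevel.qpOrbit_of_matrixSymmetric_of_smallDistinguishable`, p840908) only needs, at level `N`, ONE witness
level `ν` with `deg f_N · ν ≤ N`; so witnesses of size LINEAR IN THE PATTERN suffice for degree `√N`.  This file records
that form of the rung, whose input (W1-lin) is what the unconditional apex witnesses of `CFIHomMonotoneApex`
(`exists_homIndist_apexWitness_of_embedding`: every bipartite pattern containing an INDUCED 2-subdivision of a connected
base of tree-width `≥ k` and bounded degree) discharge for sparse wide patterns:

  (W1-lin)_C : every isolated-vertex-free bipartite pattern `E ⊆ Fin a × Fin b` with `tw(patternGraph E) ≥ k` has a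
               `HomIndist ν k`-pair of points of `ℂ^{ν×ν}` separating `hom_E`, for some `ν ≤ C · (a + b + 1)`.

* `exists_homIndist_witness_mono` — witnesses PAD UPWARD: a separating `HomIndist ν k`-pair for an isolated-free pattern
  gives one at every level `n ≥ ν` (zero-extension, `DirectSumCongruence.homIndist_zeroExtend` /
  `eval_homPoly_zeroExtend`, p840830);
* `qpOrbitSymm_of_linearWitness` — **THE LINEAR-WITNESS RUNG**: under (W1-lin)_C every matrix-symmetric family determined
  at width `(log₂ N + c₀)^c₀` with `deg f_N · C(2 deg f_N + 1) ≤ N` has `QPOrbitSymm f`;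
* `widthRung_sqrt_of_linearWitness` — in the ladder's format: (W1-lin)_C ⇒ `WidthRung (fun n => Nat.sqrt n / (3C+3))`
  (`IsVPFamily` idle, as in every rung of this family).

Honest label: a conditional rung; (W1-lin) is discharged in the tree only for patterns containing an induced wide
2-subdivision of bounded degree (apex witnesses); for general sparse patterns it needs the excluded-grid theorem BY NAME plus
an induced 2-subdivided subcubic wide subgraph, and for dense patterns (`K_{d,d}`) it is open.  No stub closed; θ₁, the
cruxes and VP ≠ VNP NOT moved. [cite: DawarPagoSeppelt2025, Thm 7.9, §7.1.1; DawarWilsenach2025, §3.3]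
-/

set_option linter.dupNamespace false

noncomputable section

open scoped Classical

namespace Summit.ValiantsHypothesis.ValiantsHypothesis.Theorems.CFIHomMonotone

open MvPolynomial
open Literature.Computability.AlgebraicComplexity
open Summit.ValiantsHypothesis.ValiantsHypothesis.Theorems.MonotoneRestorationQPLinearWidth
open Summit.ValiantsHypothesis.ValiantsHypothesis.Theorems.IsolationAnyLevel

/-- **Witnesses pad upward.**  A `HomIndist ν k`-pair separating the homomorphism polynomial of an isolated-vertex-free
pattern at level `ν` yields one at every level `n ≥ ν` (zero-extension along `Fin.castLE`). [cite: DawarPagoSeppelt2025, §7.1.1] -/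
theorem exists_homIndist_witness_mono {a b ν n k : ℕ} (E : Multiset (Fin a × Fin b))
    (hrow : ∀ i, ∃ e ∈ E, e.1 = i) (hcol : ∀ j, ∃ e ∈ E, e.2 = j) (hνn : ν ≤ n)
    (h : ∃ z z' : Fin ν × Fin ν → ℂ, HomIndist ν k z z' ∧ eval z (homPoly E ν ℂ) ≠ eval z' (homPoly E ν ℂ)) :
    ∃ Z Z' : Fin n × Fin n → ℂ, HomIndist n k Z Z' ∧ eval Z (homPoly E n ℂ) ≠ eval Z' (homPoly E n ℂ) := by
  obtain ⟨z, z', hzz', hne⟩ := h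
  have hι : Function.Injective (Fin.castLE hνn) := Fin.castLE_injective hνn
  obtain ⟨Z, hZ, hZ0⟩ := LevelDownward.exists_zeroExtend (Fin.castLE hνn) hι z
  obtain ⟨Z', hZ', hZ'0⟩ := LevelDownward.exists_zeroExtend (Fin.castLE hνn) hι z'
  refine ⟨Z, Z', DirectSumCongruence.homIndist_zeroExtend (Fin.castLE hνn) hι hZ hZ0 hZ' hZ'0 hzz', ?_⟩
  rwa [DirectSumCongruence.eval_homPoly_zeroExtend (Fin.castLE hνn) hι hZ hZ0 E hrow hcol,
    DirectSumCongruence.eval_homPoly_zeroExtend (Fin.castLE hνn) hι hZ' hZ'0 E hrow hcol]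

/-- **THE LINEAR-WITNESS RUNG.**  Assume (W1-lin)_C.  Then every matrix-symmetric family `f` determined at width
`(log₂ N + c₀)^c₀` at every level and with `deg f_N · C(2·deg f_N + 1) ≤ N` has square-symmetric circuits of
quasi-polynomial orbit size (`QPOrbitSymm f`).  Mechanism: at level `N` take `ν = C(2 deg f_N + 1)`; every wide pattern of
the non-isomorphic expansion has `≤ deg f_N` vertices a side, so its (W1-lin) witness lives at a level `≤ ν` and pads up to
`ν`; then Kronecker isolation (p840908) and K2/K3. [cite: DawarPagoSeppelt2025, Thm 7.9, §7.1.1; DawarWilsenach2025, §3.3] -/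
theorem qpOrbitSymm_of_linearWitness (C : ℕ)
    (hW : ∀ (k a b : ℕ) (E : Multiset (Fin a × Fin b)),
      (∀ u : Fin a, ∃ x ∈ E, x.1 = u) → (∀ v : Fin b, ∃ x ∈ E, x.2 = v) →
      k ≤ Literature.Combinatorics.SimpleGraph.treewidth (patternGraph E) →
      ∃ ν : ℕ, ν ≤ C * (a + b + 1) ∧ ∃ z z' : Fin ν × Fin ν → ℂ, HomIndist ν k z z' ∧
        eval z (homPoly E ν ℂ) ≠ eval z' (homPoly E ν ℂ))
    (f : (n : ℕ) → MvPolynomial (Fin n × Fin n) ℂ) (hsym : IsMatrixSymmetric f) (c₀ : ℕ)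
    (hdet : ∀ (n : ℕ) (A B : Fin n × Fin n → ℂ), HomIndist n ((Nat.log 2 n + c₀) ^ c₀) A B →
      eval A (f n) = eval B (f n))
    (hdeg : ∀ n : ℕ, (f n).totalDegree * (C * (2 * (f n).totalDegree + 1)) ≤ n) :
    QPOrbitSymm f := by
  refine ⟨c₀ + 3, fun N => qpOrbit_of_matrixSymmetric_of_smallDistinguishable f c₀ hsym hdet (fun n => ?_) N⟩
  refine ⟨C * (2 * (f n).totalDegree + 1), hdeg n, fun a b E ha hb hrow hcol htw => ?_⟩
  obtain ⟨ν, hν, hwit⟩ := hW _ a b E hrow hcol htw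
  have hνle : ν ≤ C * (2 * (f n).totalDegree + 1) :=
    hν.trans (Nat.mul_le_mul_left C (by omega))
  exact exists_homIndist_witness_mono E hrow hcol hνle hwit

/-- **The linear-witness rung in the ladder's format**: (W1-lin)_C ⇒ `WidthRung (fun n => Nat.sqrt n / (3C + 3))` — every
matrix-symmetric `VP` family of degree `≤ √n / (3C+3)` that is `PolylogHomDetermined` has `QPOrbitSymm`.
[cite: DawarPagoSeppelt2025, Thm 7.9; DawarWilsenach2025, §3.3] -/
theorem widthRung_sqrt_of_linearWitness (C : ℕ)
    (hW : ∀ (k a b : ℕ) (E : Multiset (Fin a × Fin b)),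
      (∀ u : Fin a, ∃ x ∈ E, x.1 = u) → (∀ v : Fin b, ∃ x ∈ E, x.2 = v) →
      k ≤ Literature.Combinatorics.SimpleGraph.treewidth (patternGraph E) →
      ∃ ν : ℕ, ν ≤ C * (a + b + 1) ∧ ∃ z z' : Fin ν × Fin ν → ℂ, HomIndist ν k z z' ∧
        eval z (homPoly E ν ℂ) ≠ eval z' (homPoly E ν ℂ)) :
    WidthRung fun n => Nat.sqrt n / (3 * C + 3) := by
  intro f hsym _hVP hdegle hdet
  obtain ⟨c₀, hc₀⟩ := hdet
  refine qpOrbitSymm_of_linearWitness C hW f hsym c₀ hc₀ fun n => ?_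
  have h0 : (f n).totalDegree ≤ Nat.sqrt n / (3 * C + 3) := hdegle n
  set d := (f n).totalDegree with hd
  set s := Nat.sqrt n with hs
  have h1 : (3 * C + 3) * d ≤ s :=
    calc (3 * C + 3) * d ≤ (3 * C + 3) * (s / (3 * C + 3)) := Nat.mul_le_mul_left _ h0
      _ ≤ s := Nat.mul_div_le s (3 * C + 3)
  have h2 : s * s ≤ n := Nat.sqrt_le n
  have h3 : d ≤ d * d := by
    rcases Nat.eq_zero_or_pos d with h | h
    · simp [h]
    · exact Nat.le_mul_of_pos_left d h
  have h4 : (3 * C + 3) * d * ((3 * C + 3) * d) ≤ s * s := Nat.mul_le_mul h1 h1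
  nlinarith [h1, h2, h3, h4]


/-! ### Two widths (appended): indistinguishability below `k`, tree-width cut at a polynomial `g k` -/

/-- **THE LINEAR-WITNESS RUNG, TWO-WIDTH FORM.**  Assume (W1-lin)_{C,g}: every isolated-vertex-free bipartite pattern
`E ⊆ Fin a × Fin b` with `tw(patternGraph E) ≥ g k` has a `HomIndist ν k`-pair separating `hom_E` at some level
`ν ≤ C(a+b+1)`, where `g k ≤ (k+2)^e` is polynomially bounded (the shape delivered by an induced-wall theorem for bounded
degree, e.g. Korhonen 2023, composed with the apex witnesses of `CFIHomMonotoneApex`).  Then every matrix-symmetric family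
determined at width `(log₂ N + c₀)^c₀` with `deg f_N · C(2 deg f_N + 1) ≤ N` has `QPOrbitSymm f` (orbit bound
`2^((log₂ N + c' + 3)^(c'+3))`, `(log₂ N + c')^{c'} ≥ g((log₂ N + c₀)^c₀)`). [cite: DawarPagoSeppelt2025, Thm 7.3, Thm 7.9, §7.1.1] -/
theorem qpOrbitSymm_of_linearWitness₂ (C : ℕ) (g : ℕ → ℕ) (e : ℕ) (hg : ∀ k, g k ≤ (k + 2) ^ e)
    (hW : ∀ (k a b : ℕ) (E : Multiset (Fin a × Fin b)),
      (∀ u : Fin a, ∃ x ∈ E, x.1 = u) → (∀ v : Fin b, ∃ x ∈ E, x.2 = v) →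
      g k ≤ Literature.Combinatorics.SimpleGraph.treewidth (patternGraph E) →
      ∃ ν : ℕ, ν ≤ C * (a + b + 1) ∧ ∃ z z' : Fin ν × Fin ν → ℂ, HomIndist ν k z z' ∧
        eval z (homPoly E ν ℂ) ≠ eval z' (homPoly E ν ℂ))
    (f : (n : ℕ) → MvPolynomial (Fin n × Fin n) ℂ) (hsym : IsMatrixSymmetric f) (c₀ : ℕ)
    (hdet : ∀ (n : ℕ) (A B : Fin n × Fin n → ℂ), HomIndist n ((Nat.log 2 n + c₀) ^ c₀) A B →
      eval A (f n) = eval B (f n))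
    (hdeg : ∀ n : ℕ, (f n).totalDegree * (C * (2 * (f n).totalDegree + 1)) ≤ n) :
    QPOrbitSymm f := by
  obtain ⟨c', hc'⟩ := SmallWitnessRung.exists_polylog_dominates c₀ e
  refine ⟨c' + 3, fun N => qpOrbit_of_matrixSymmetric_of_smallDistinguishable₂ f c₀ c' hsym hdet (fun n => ?_) N⟩
  refine ⟨C * (2 * (f n).totalDegree + 1), hdeg n, fun a b E ha hb hrow hcol htw => ?_⟩
  obtain ⟨ν, hν, hwit⟩ := hW ((Nat.log 2 n + c₀) ^ c₀) a b E hrow hcol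
    (le_trans ((hg _).trans (hc' (Nat.log 2 n))) htw)
  have hνle : ν ≤ C * (2 * (f n).totalDegree + 1) :=
    hν.trans (Nat.mul_le_mul_left C (by omega))
  exact exists_homIndist_witness_mono E hrow hcol hνle hwit

/-- **Two-width form in the ladder's format**: (W1-lin)_{C,g} with `g` polynomially bounded ⇒
`WidthRung (fun n => Nat.sqrt n / (3C + 3))`. [cite: DawarPagoSeppelt2025, Thm 7.3, Thm 7.9] -/
theorem widthRung_sqrt_of_linearWitness₂ (C : ℕ) (g : ℕ → ℕ) (e : ℕ) (hg : ∀ k, g k ≤ (k + 2) ^ e)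
    (hW : ∀ (k a b : ℕ) (E : Multiset (Fin a × Fin b)),
      (∀ u : Fin a, ∃ x ∈ E, x.1 = u) → (∀ v : Fin b, ∃ x ∈ E, x.2 = v) →
      g k ≤ Literature.Combinatorics.SimpleGraph.treewidth (patternGraph E) →
      ∃ ν : ℕ, ν ≤ C * (a + b + 1) ∧ ∃ z z' : Fin ν × Fin ν → ℂ, HomIndist ν k z z' ∧
        eval z (homPoly E ν ℂ) ≠ eval z' (homPoly E ν ℂ)) :
    WidthRung fun n => Nat.sqrt n / (3 * C + 3) := by
  intro f hsym _hVP hdegle hdet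
  obtain ⟨c₀, hc₀⟩ := hdet
  refine qpOrbitSymm_of_linearWitness₂ C g e hg hW f hsym c₀ hc₀ fun n => ?_
  have h0 : (f n).totalDegree ≤ Nat.sqrt n / (3 * C + 3) := hdegle n
  set d := (f n).totalDegree with hd
  set s := Nat.sqrt n with hs
  have h1 : (3 * C + 3) * d ≤ s :=
    calc (3 * C + 3) * d ≤ (3 * C + 3) * (s / (3 * C + 3)) := Nat.mul_le_mul_left _ h0
      _ ≤ s := Nat.mul_div_le s (3 * C + 3)
  have h2 : s * s ≤ n := Nat.sqrt_le n
  have h3 : d ≤ d * d := by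
    rcases Nat.eq_zero_or_pos d with h | h
    · simp [h]
    · exact Nat.le_mul_of_pos_left d h
  have h4 : (3 * C + 3) * d * ((3 * C + 3) * d) ≤ s * s := Nat.mul_le_mul h1 h1
  nlinarith [h1, h2, h3, h4]

end Summit.ValiantsHypothesis.ValiantsHypothesis.Theorems.CFIHomMonotone

end
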